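import Summits.AnomalousDissipation.AnomalousDissipation.Theorems.MomentParityMomentLadderLineConverse

/-!
# `MomentParity.GalerkinInvariantLoud` (stmt-AnomalousDissipation-14283): the named cross-route bridge
# `MirrorVariety.GalerkinSteadyZerothLaw → MomentParity.GalerkinInvariantLoud`

The crux `GalerkinInvariantLoud` (GIL: loud, bounded, level-`N` Galerkin-INVARIANT laws along `ν_j → 0`, the
Galerkin-ensemble zeroth law) has, after six line leads (seats 0, c1–c5) and a strategist census, no line whose
hardest stub is below GIL itself.  What the tree DOES hold is a kernel-checked sufficient condition living on a
sibling route: loud bounded Galerkin STEADY states (`MirrorVariety.GalerkinSteadyZerothLaw`, crux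
stmt-AnomalousDissipation-2986) give the MomentParity target `MomentLadder` (`MomentLadder_of_galerkinSteadyZerothLaw`,
file `MomentParityMomentLadderLine.lean`: Dirac masses at bounded steady states are loud invariant laws with an
`N`-uniform quadratic enstrophy moment), and `MomentLadder → GalerkinInvariantLoud` by forgetting the resolution
schedule and closing the moments at every degree (`galerkinInvariantLoud_of_MomentLadder`, file
`MomentParityMomentLadderLineConverse.lean`).

This file only NAMES the composition on the GIL item, so that the park target of stmt-14283 is a declaration and
the negatives index carries the contrapositive:

* `galerkinInvariantLoud_of_galerkinSteadyZerothLaw : GalerkinSteadyZerothLaw → GalerkinInvariantLoud`;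
* `not_galerkinSteadyZerothLaw_of_not_galerkinInvariantLoud : ¬ GalerkinInvariantLoud → ¬ GalerkinSteadyZerothLaw`
  (a refutation of the Galerkin-ensemble zeroth law refutes the Galerkin-steady one of route MirrorVariety).

Both are unconditional implications between two OPEN route declarations; neither item is credited.

References: Foias–Manley–Rosa–Temam, *Navier–Stokes Equations and Turbulence* (CUP 2001), Ch. IV §1.2 (Dirac
measures at steady states are stationary statistical solutions); the two imported tree files.
-/

set_option linter.dupNamespace false

noncomputable section

namespace Summit.AnomalousDissipation.AnomalousDissipation.Theorems.GalerkinInvariantLoud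

open Summit.AnomalousDissipation.AnomalousDissipation.Theses.MomentParity
open Summit.AnomalousDissipation.AnomalousDissipation.Theorems.MomentLadder

/-- **Cross-route bridge (steady corner of the crux).** Loud bounded Galerkin steady states along `ν_j → 0`
(`MirrorVariety.GalerkinSteadyZerothLaw`, stmt-AnomalousDissipation-2986) imply the Galerkin-ensemble zeroth law
`MomentParity.GalerkinInvariantLoud` (stmt-AnomalousDissipation-14283): compose the landed
`MomentLadder_of_galerkinSteadyZerothLaw` with the landed `galerkinInvariantLoud_of_MomentLadder`. [folklore] -/
theorem galerkinInvariantLoud_of_galerkinSteadyZerothLaw :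
    Summit.AnomalousDissipation.AnomalousDissipation.Theses.MirrorVariety.GalerkinSteadyZerothLaw →
      GalerkinInvariantLoud :=
  fun h => galerkinInvariantLoud_of_MomentLadder (MomentLadder_of_galerkinSteadyZerothLaw h)

/-- Contrapositive, for the negatives index: refuting the Galerkin-ensemble zeroth law `GalerkinInvariantLoud`
(stmt-14283) refutes the Galerkin-steady zeroth law of route MirrorVariety (stmt-2986). [folklore] -/
theorem not_galerkinSteadyZerothLaw_of_not_galerkinInvariantLoud (h : ¬ GalerkinInvariantLoud) :
    ¬ Summit.AnomalousDissipation.AnomalousDissipation.Theses.MirrorVariety.GalerkinSteadyZerothLaw :=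
  fun hS => h (galerkinInvariantLoud_of_galerkinSteadyZerothLaw hS)

end Summit.AnomalousDissipation.AnomalousDissipation.Theorems.GalerkinInvariantLoud

end
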